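import Summits.CriticalPhenomena.PercolationContinuityZ3.Theorems.PercTreeValueEquilateralAntiFactorisationFlowDefs
import Summits.CriticalPhenomena.PercolationContinuityZ3.Theorems.PercTreeValueEquilateralAntiFactorisationHalfsum
import Summits.CriticalPhenomena.PercolationContinuityZ3.Theorems.PercTreeValueEquilateralAntiFactorisationPivotalOpen
import Summits.CriticalPhenomena.PercolationContinuityZ3.Theorems.PercTreeValueEquilateralAntiFactorisationPivotalContinuous
import Summits.CriticalPhenomena.PercolationContinuityZ3.Theorems.PercTreeValueEquilateralAntiFactorisationPos
import Summits.CriticalPhenomena.PercolationContinuityZ3.Theorems.PercTreeValueEquilateralAntiFactorisationBoxLimit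
import Literature.Probability.Percolation.CriticalContinuityProofs
import HarnessLib

/-!
# Russo flow of the three-point log-ratio in a box (crux `EquilateralAntiFactorisation`,
# stmt-CriticalPhenomena-7800, line `Sketch`)

With the objects of `PercTreeValueEquilateralAntiFactorisationFlowDefs.lean`
(`mu`, `evA/evB/evC/evT`, `pivInt`, `flowIntegrand = g_{n,r}`, `boxLogRatio = F_{n,r}`,
`infLogRatio = log R_r²`) this file proves the bookkeeping of the line, all unconditional:

* `hasDerivAt_boxLogRatio` — `d/dq F_{n,r}(q) = g_{n,r}(q)` on `(0,1)` (Russo's formula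
  `russo_formula_holds` for the four increasing box events, chain rule for `log`);
* `flow_identity` — `∫_p^{p'} g_{n,r} = F_{n,r}(p') − F_{n,r}(p)` for `0 < p ≤ p' < 1` (FTC; the
  integrand is continuous by `stub_pivotalContinuous`, positivity by `stub_pos`);
* `tendsto_boxLogRatio` — box exhaustion `F_{n,r}(q) → log R_r(q)²` as `n → ∞` (`stub_boxLimit`);
* `flowIntegrand_eq_deficit` — the reading of the integrand as the third-point pivotal deficit,
  `g(q) = (1/q)·(E_q[N_A+N_B+N_C ; T]/P(T) − Σ_P E_q[N_P ; P]/P(P))`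
  (two-of-three identity `stub_halfsum` and `E[N_E ; E] = q E[N_E]`, `stub_pivotalOpen`).

The certificate `crux ⟺ window deficit` built on these is in
`PercTreeValueEquilateralAntiFactorisationFlowCertificate.lean`. Sources: Russo 1981 §4,
Grimmett 1999 §2.4 / Thm 2.25; cards `Cruxes/EquilateralAntiFactorisation/Ideas/pivotal-deficit-flow.md`,
`pivotal-thinning-flow.md`.
-/

noncomputable section

namespace Summit.CriticalPhenomena.PercolationContinuityZ3.Theorems.EquilateralAntiFactorisation.Flow

open MeasureTheory Filter Topology
open Literature.Probability.Percolation Literature.Probability.LatticeModels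

/-- `0 < p_c(ℤ³)`. -/
theorem pc_pos : 0 < (criticalProbI 3 : ℝ) :=
  (Grimmett1999_criticalProb_pos_lt_one_holds 3 (by norm_num)).1

/-- `p_c(ℤ³) < 1`. -/
theorem pc_lt_one : (criticalProbI 3 : ℝ) < 1 :=
  (Grimmett1999_criticalProb_pos_lt_one_holds 3 (by norm_num)).2

/-- `T ⊆ A`. -/
theorem evT_subset_evA (n r : ℕ) : evT n r ⊆ evA n r := Set.inter_subset_left

/-- `T ⊆ B`. -/
theorem evT_subset_evB (n r : ℕ) : evT n r ⊆ evB n r := Set.inter_subset_right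

/-- `T ⊆ C`: `a_r ↔ 0 ↔ b_r` inside the box. -/
theorem evT_subset_evC (n r : ℕ) : evT n r ⊆ evC n r := by
  rintro ω ⟨⟨h0, ha, hr0a⟩, ⟨h0', hb, hr0b⟩⟩
  exact ⟨ha, hb, hr0a.symm.trans hr0b⟩

/-- `A` is increasing. -/
theorem isUpperSet_evA (n r : ℕ) : IsUpperSet (evA n r) := isUpperSet_openConnIn _ _ _

/-- `B` is increasing. -/
theorem isUpperSet_evB (n r : ℕ) : IsUpperSet (evB n r) := isUpperSet_openConnIn _ _ _

/-- `C` is increasing. -/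
theorem isUpperSet_evC (n r : ℕ) : IsUpperSet (evC n r) := isUpperSet_openConnIn _ _ _

/-- `T` is increasing. -/
theorem isUpperSet_evT (n r : ℕ) : IsUpperSet (evT n r) :=
  (isUpperSet_evA n r).inter (isUpperSet_evB n r)

/-- `A` is determined by the pairs of the box. -/
theorem determinedBy_evA (n r : ℕ) :
    DeterminedBy (evA n r) (↑((box 3 n).sym2) : Set (Sym2 (Site 3))) :=
  DCT16.determinedBy_openConnIn _ _ _ (by rw [Finset.coe_sym2])

/-- `B` is determined by the pairs of the box. -/
theorem determinedBy_evB (n r : ℕ) :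
    DeterminedBy (evB n r) (↑((box 3 n).sym2) : Set (Sym2 (Site 3))) :=
  DCT16.determinedBy_openConnIn _ _ _ (by rw [Finset.coe_sym2])

/-- `C` is determined by the pairs of the box. -/
theorem determinedBy_evC (n r : ℕ) :
    DeterminedBy (evC n r) (↑((box 3 n).sym2) : Set (Sym2 (Site 3))) :=
  DCT16.determinedBy_openConnIn _ _ _ (by rw [Finset.coe_sym2])

/-- `T` is determined by the pairs of the box. -/
theorem determinedBy_evT (n r : ℕ) :
    DeterminedBy (evT n r) (↑((box 3 n).sym2) : Set (Sym2 (Site 3))) :=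
  (determinedBy_evA n r).inter (determinedBy_evB n r)

/-- Continuity of `q ↦ P_q(E)` for a box-determined event. -/
theorem continuous_mu_real {E : Set (BondConfig (Site 3))} {F : Finset (Sym2 (Site 3))}
    (hE : DeterminedBy E (↑F : Set (Sym2 (Site 3)))) :
    Continuous fun q : ℝ => (mu q).real E :=
  (continuous_bondPercolation_real_of_determinedBy (zdGraph 3) hE).comp continuous_projIcc

/-- Russo's formula for `P_q(E)` in the notation of this file. -/
theorem hasDerivAt_mu_real {E : Set (BondConfig (Site 3))} (hE : IsUpperSet E)
    (hEl : IsLocalEvent E) {q : ℝ} (hq : q ∈ Set.Ioo (0 : ℝ) 1) :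
    HasDerivAt (fun q => (mu q).real E) (pivInt E q) q :=
  russo_formula_holds (zdGraph 3) hE hEl q hq

/-- `d/dq log P_q(E) = E_q[N_E] / P_q(E)`. -/
theorem hasDerivAt_log_mu_real {E : Set (BondConfig (Site 3))} (hE : IsUpperSet E)
    (hEl : IsLocalEvent E) {q : ℝ} (hq : q ∈ Set.Ioo (0 : ℝ) 1) (hpos : 0 < (mu q).real E) :
    HasDerivAt (fun q => Real.log ((mu q).real E)) (pivInt E q / (mu q).real E) q :=
  (hasDerivAt_mu_real hE hEl hq).log hpos.ne'

/-- `d/dq F_{n,r}(q) = g_{n,r}(q)` on `(0,1)` wherever `P_q(T) > 0`. -/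
theorem hasDerivAt_boxLogRatio (n r : ℕ) {q : ℝ} (hq : q ∈ Set.Ioo (0 : ℝ) 1)
    (hpos : 0 < (mu q).real (evT n r)) :
    HasDerivAt (fun q => boxLogRatio n r q) (flowIntegrand n r q) q := by
  have hA : 0 < (mu q).real (evA n r) := hpos.trans_le (measureReal_mono (evT_subset_evA n r))
  have hB : 0 < (mu q).real (evB n r) := hpos.trans_le (measureReal_mono (evT_subset_evB n r))
  have hC : 0 < (mu q).real (evC n r) := hpos.trans_le (measureReal_mono (evT_subset_evC n r))
  have dT := hasDerivAt_log_mu_real (isUpperSet_evT n r) ⟨_, determinedBy_evT n r⟩ hq hpos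
  have dA := hasDerivAt_log_mu_real (isUpperSet_evA n r) ⟨_, determinedBy_evA n r⟩ hq hA
  have dB := hasDerivAt_log_mu_real (isUpperSet_evB n r) ⟨_, determinedBy_evB n r⟩ hq hB
  have dC := hasDerivAt_log_mu_real (isUpperSet_evC n r) ⟨_, determinedBy_evC n r⟩ hq hC
  show HasDerivAt (fun q => 2 * Real.log ((mu q).real (evT n r)) - Real.log ((mu q).real (evA n r)) -
    Real.log ((mu q).real (evB n r)) - Real.log ((mu q).real (evC n r))) (flowIntegrand n r q) q
  exact (((dT.const_mul 2).sub dA).sub dB).sub dC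

/-- `g_{n,r}` is continuous on any set where `P_q(T) > 0`. -/
theorem continuousOn_flowIntegrand (n r : ℕ) {s : Set ℝ}
    (hpos : ∀ q ∈ s, 0 < (mu q).real (evT n r)) : ContinuousOn (flowIntegrand n r) s := by
  have hA : ∀ q ∈ s, (mu q).real (evA n r) ≠ 0 := fun q hq =>
    ((hpos q hq).trans_le (measureReal_mono (evT_subset_evA n r))).ne'
  have hB : ∀ q ∈ s, (mu q).real (evB n r) ≠ 0 := fun q hq =>
    ((hpos q hq).trans_le (measureReal_mono (evT_subset_evB n r))).ne'
  have hC : ∀ q ∈ s, (mu q).real (evC n r) ≠ 0 := fun q hq =>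
    ((hpos q hq).trans_le (measureReal_mono (evT_subset_evC n r))).ne'
  have hT : ∀ q ∈ s, (mu q).real (evT n r) ≠ 0 := fun q hq => (hpos q hq).ne'
  have cT : ContinuousOn (fun q => pivInt (evT n r) q / (mu q).real (evT n r)) s :=
    (stub_pivotalContinuous (zdGraph 3) ⟨_, determinedBy_evT n r⟩).continuousOn.div
      (continuous_mu_real (determinedBy_evT n r)).continuousOn hT
  have cA : ContinuousOn (fun q => pivInt (evA n r) q / (mu q).real (evA n r)) s :=
    (stub_pivotalContinuous (zdGraph 3) ⟨_, determinedBy_evA n r⟩).continuousOn.div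
      (continuous_mu_real (determinedBy_evA n r)).continuousOn hA
  have cB : ContinuousOn (fun q => pivInt (evB n r) q / (mu q).real (evB n r)) s :=
    (stub_pivotalContinuous (zdGraph 3) ⟨_, determinedBy_evB n r⟩).continuousOn.div
      (continuous_mu_real (determinedBy_evB n r)).continuousOn hB
  have cC : ContinuousOn (fun q => pivInt (evC n r) q / (mu q).real (evC n r)) s :=
    (stub_pivotalContinuous (zdGraph 3) ⟨_, determinedBy_evC n r⟩).continuousOn.div
      (continuous_mu_real (determinedBy_evC n r)).continuousOn hC
  exact (((continuousOn_const.mul cT).sub cA).sub cB).sub cC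

/-- **The flow identity** (Russo + FTC, in the box): for `0 < p ≤ p' < 1` with `P_q(T) > 0` on
`[p, p']`, `∫_p^{p'} g_{n,r}(q) dq = F_{n,r}(p') − F_{n,r}(p)`. -/
theorem flow_identity (n r : ℕ) {p p' : ℝ} (hp : 0 < p) (hpp' : p ≤ p') (hp' : p' < 1)
    (hpos : ∀ q ∈ Set.Icc p p', 0 < (mu q).real (evT n r)) :
    ∫ q in p..p', flowIntegrand n r q = boxLogRatio n r p' - boxLogRatio n r p := by
  refine intervalIntegral.integral_eq_sub_of_hasDerivAt (fun q hq => ?_) ?_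
  · rw [Set.uIcc_of_le hpp'] at hq
    exact hasDerivAt_boxLogRatio n r ⟨hp.trans_le hq.1, hq.2.trans_lt hp'⟩ (hpos q hq)
  · refine ContinuousOn.intervalIntegrable ?_
    rw [Set.uIcc_of_le hpp']
    exact continuousOn_flowIntegrand n r hpos

/-- Positivity of the box triple event for `0 < q ≤ 1`, `r ≤ n`. -/
theorem evT_pos {q : ℝ} (hq : 0 < q) (hq1 : q ≤ 1) {n r : ℕ} (hrn : r ≤ n) :
    0 < (mu q).real (evT n r) := by
  have hq' : 0 < ((Set.projIcc (0 : ℝ) 1 zero_le_one q : unitInterval) : ℝ) := by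
    rw [Set.projIcc_of_mem _ ⟨hq.le, hq1⟩]; exact hq
  exact stub_pos (Set.projIcc 0 1 zero_le_one q) hq' n r hrn

/-- Positivity of the infinite-volume triple event for `0 < q ≤ 1`. -/
theorem infT_pos (r : ℕ) {q : ℝ} (hq : 0 < q) (hq1 : q ≤ 1) :
    0 < (mu q).real (openConn 0 (ptA r) ∩ openConn 0 (ptB r)) :=
  (evT_pos hq hq1 le_rfl).trans_le (measureReal_mono
    (Set.inter_subset_inter (openConnIn_subset_openConn _ _ _) (openConnIn_subset_openConn _ _ _)))

/-- `{0↔a} ∩ {0↔b} ⊆ {a↔b}`. -/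
theorem infT_subset_C (r : ℕ) :
    (openConn 0 (ptA r) ∩ openConn 0 (ptB r) : Set (BondConfig (Site 3))) ⊆ openConn (ptA r) (ptB r) :=
  fun _ h => SimpleGraph.Reachable.trans (SimpleGraph.Reachable.symm h.1) h.2

/-- **Box exhaustion of the log-ratio**: `F_{n,r}(q) → log R_r(q)²` as `n → ∞` (`0 < q ≤ 1`). -/
theorem tendsto_boxLogRatio (r : ℕ) {q : ℝ} (hq : 0 < q) (hq1 : q ≤ 1) :
    Tendsto (fun n => boxLogRatio n r q) atTop (𝓝 (infLogRatio r q)) := by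
  have hT := infT_pos r hq hq1
  have hA : 0 < (mu q).real (openConn 0 (ptA r)) := hT.trans_le (measureReal_mono Set.inter_subset_left)
  have hB : 0 < (mu q).real (openConn 0 (ptB r)) := hT.trans_le (measureReal_mono Set.inter_subset_right)
  have hC : 0 < (mu q).real (openConn (ptA r) (ptB r)) := hT.trans_le (measureReal_mono (infT_subset_C r))
  have lT : Tendsto (fun n => (mu q).real (evT n r)) atTop
      (𝓝 ((mu q).real (openConn 0 (ptA r) ∩ openConn 0 (ptB r)))) :=
    stub_boxLimit _ 0 (ptA r) (ptB r)
  have lA : Tendsto (fun n => (mu q).real (evA n r)) atTop (𝓝 ((mu q).real (openConn 0 (ptA r)))) := by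
    have h := stub_boxLimit (Set.projIcc (0 : ℝ) 1 zero_le_one q) 0 (ptA r) (ptA r)
    simp only [Set.inter_self] at h
    exact h
  have lB : Tendsto (fun n => (mu q).real (evB n r)) atTop (𝓝 ((mu q).real (openConn 0 (ptB r)))) := by
    have h := stub_boxLimit (Set.projIcc (0 : ℝ) 1 zero_le_one q) 0 (ptB r) (ptB r)
    simp only [Set.inter_self] at h
    exact h
  have lC : Tendsto (fun n => (mu q).real (evC n r)) atTop
      (𝓝 ((mu q).real (openConn (ptA r) (ptB r)))) := by
    have h := stub_boxLimit (Set.projIcc (0 : ℝ) 1 zero_le_one q) (ptA r) (ptB r) (ptB r)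
    simp only [Set.inter_self] at h
    exact h
  unfold boxLogRatio infLogRatio
  exact ((((Real.continuousAt_log hT.ne').tendsto.comp lT).const_mul 2).sub
    ((Real.continuousAt_log hA.ne').tendsto.comp lA)).sub
    ((Real.continuousAt_log hB.ne').tendsto.comp lB) |>.sub
    ((Real.continuousAt_log hC.ne').tendsto.comp lC)

/-! ### Reading of the integrand: `g = (1/q) · Σ_P (E_q[N_P | T] − E_q[N_P | P])` -/

/-- Pivotal pairs of an event determined by the finite set `↑F` lie in `F`; in particular the
pivotal set is finite. -/
theorem pivotals_inter_finite {E : Set (BondConfig (Site 3))} {F : Finset (Sym2 (Site 3))}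
    (hE : DeterminedBy E (↑F : Set (Sym2 (Site 3)))) (ω : BondConfig (Site 3)) (K : Set (Sym2 (Site 3))) :
    (pivotals E ω ∩ K).Finite :=
  (F.finite_toSet.subset fun _ he => Russo.mem_of_isPivotal hE he).subset Set.inter_subset_left

/-- `E_q[N_E ; E] = q · E_q[N_E]` for the box events (stub S2 at the clamped parameter). -/
theorem setIntegral_pivCount {E : Set (BondConfig (Site 3))} (hE : IsUpperSet E) (hEl : IsLocalEvent E)
    {q : ℝ} (hq : q ∈ Set.Icc (0 : ℝ) 1) :
    ∫ ω in E, pivCount E ω ∂(mu q) = q * pivInt E q := by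
  have h := stub_pivotalOpen (zdGraph 3) (Set.projIcc (0 : ℝ) 1 zero_le_one q) hE hEl
  have hcoe : ((Set.projIcc (0 : ℝ) 1 zero_le_one q : unitInterval) : ℝ) = q := by
    rw [Set.projIcc_of_mem _ hq]
  rw [hcoe] at h
  exact h

/-- On `T`, `2 N_T = N_A + N_B + N_C` (stub S1, read through `ncard` on finite sets). -/
theorem two_mul_pivCount_evT (n r : ℕ) {ω : BondConfig (Site 3)} (hω : ω ∈ evT n r) :
    2 * pivCount (evT n r) ω = pivCount (evA n r) ω + pivCount (evB n r) ω + pivCount (evC n r) ω := by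
  have h : 2 * (pivotals (evT n r) ω ∩ (zdGraph 3).edgeSet).encard =
      (pivotals (evA n r) ω ∩ (zdGraph 3).edgeSet).encard + (pivotals (evB n r) ω ∩ (zdGraph 3).edgeSet).encard +
        (pivotals (evC n r) ω ∩ (zdGraph 3).edgeSet).encard :=
    stub_halfsum (↑(box 3 n) : Set (Site 3)) (0 : Site 3) (ptA r) (ptB r) (zdGraph 3).edgeSet ω hω
  have hT := pivotals_inter_finite (determinedBy_evT n r) ω (zdGraph 3).edgeSet
  have hA := pivotals_inter_finite (determinedBy_evA n r) ω (zdGraph 3).edgeSet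
  have hB := pivotals_inter_finite (determinedBy_evB n r) ω (zdGraph 3).edgeSet
  have hC := pivotals_inter_finite (determinedBy_evC n r) ω (zdGraph 3).edgeSet
  rw [← hT.cast_ncard_eq, ← hA.cast_ncard_eq, ← hB.cast_ncard_eq, ← hC.cast_ncard_eq] at h
  have h' : 2 * (pivotals (evT n r) ω ∩ (zdGraph 3).edgeSet).ncard =
      (pivotals (evA n r) ω ∩ (zdGraph 3).edgeSet).ncard + (pivotals (evB n r) ω ∩ (zdGraph 3).edgeSet).ncard +
        (pivotals (evC n r) ω ∩ (zdGraph 3).edgeSet).ncard := by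
    exact_mod_cast h
  change 2 * ((pivotals (evT n r) ω ∩ (zdGraph 3).edgeSet).ncard : ℝ) =
    ((pivotals (evA n r) ω ∩ (zdGraph 3).edgeSet).ncard : ℝ) + ((pivotals (evB n r) ω ∩ (zdGraph 3).edgeSet).ncard : ℝ) +
      ((pivotals (evC n r) ω ∩ (zdGraph 3).edgeSet).ncard : ℝ)
  exact_mod_cast h'

/-- **The integrand is the third-point pivotal deficit**: for `q ∈ (0,1)`,
`g_{n,r}(q) = (1/q) · ( E_q[N_A + N_B + N_C ; T]/P_q(T) − E_q[N_A ; A]/P_q(A) − E_q[N_B ; B]/P_q(B) − E_q[N_C ; C]/P_q(C) )`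
`= (1/q) Σ_{P ∈ {A,B,C}} ( E_q[N_P | T] − E_q[N_P | P] )` — the cards' `Σ_P D_P(q)/q = −Σ_P Π_P(q)/q`. -/
theorem flowIntegrand_eq_deficit (n r : ℕ) {q : ℝ} (hq : q ∈ Set.Ioo (0 : ℝ) 1) :
    flowIntegrand n r q = (1 / q) *
      ((∫ ω in evT n r, (pivCount (evA n r) ω + pivCount (evB n r) ω + pivCount (evC n r) ω) ∂(mu q)) /
          (mu q).real (evT n r) -
        (∫ ω in evA n r, pivCount (evA n r) ω ∂(mu q)) / (mu q).real (evA n r) -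
        (∫ ω in evB n r, pivCount (evB n r) ω ∂(mu q)) / (mu q).real (evB n r) -
        (∫ ω in evC n r, pivCount (evC n r) ω ∂(mu q)) / (mu q).real (evC n r)) := by
  have hqI : q ∈ Set.Icc (0 : ℝ) 1 := ⟨hq.1.le, hq.2.le⟩
  have hq0 : q ≠ 0 := hq.1.ne'
  have hT := setIntegral_pivCount (isUpperSet_evT n r) ⟨_, determinedBy_evT n r⟩ hqI
  have hA := setIntegral_pivCount (isUpperSet_evA n r) ⟨_, determinedBy_evA n r⟩ hqI
  have hB := setIntegral_pivCount (isUpperSet_evB n r) ⟨_, determinedBy_evB n r⟩ hqI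
  have hC := setIntegral_pivCount (isUpperSet_evC n r) ⟨_, determinedBy_evC n r⟩ hqI
  have hsum : ∫ ω in evT n r, (pivCount (evA n r) ω + pivCount (evB n r) ω + pivCount (evC n r) ω) ∂(mu q) =
      2 * (q * pivInt (evT n r) q) := by
    rw [← hT, ← integral_const_mul]
    refine setIntegral_congr_fun (determinedBy_evT n r).measurableSet_of_finset (fun ω hω => ?_)
    exact (two_mul_pivCount_evT n r hω).symm
  rw [hsum, hA, hB, hC]
  unfold flowIntegrand
  field_simp

end Summit.CriticalPhenomena.PercolationContinuityZ3.Theorems.EquilateralAntiFactorisation.Flow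

end
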